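import Summits.CriticalPhenomena.PercolationContinuityZ3.Theorems.PercNearOneGluingNoHeavyPcintKernZ6S4Defs
import HarnessLib

/-!
# PCINT lane, kernel check 2/4 of the B2r window certificate `d = 6`, memory 4 (3-step windows, 1728 codes): codes `432 ≤ c < 864`

Cell `prim-pcint`, seat `prim-pcint-2` (gen 2).  Collatz–Wielandt rows `10^5 · row ≤ 99999 · DEN · v` for the window codes in
`[432, 864)`, by `decide +kernel` in chunks of `108` codes (natural-number arithmetic only; `maxHeartbeats 0`).
Does NOT build on p205010.
-/

namespace Summit.CriticalPhenomena.PercolationContinuityZ3.Theorems.Pcint.Z6S4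

set_option maxHeartbeats 0 in
/-- Rows `432 ≤ c < 540` of the certificate hold. [folklore] -/
theorem chk_432_540 : chk 432 540 = true := by decide +kernel

set_option maxHeartbeats 0 in
/-- Rows `540 ≤ c < 648` of the certificate hold. [folklore] -/
theorem chk_540_648 : chk 540 648 = true := by decide +kernel

set_option maxHeartbeats 0 in
/-- Rows `648 ≤ c < 756` of the certificate hold. [folklore] -/
theorem chk_648_756 : chk 648 756 = true := by decide +kernel

set_option maxHeartbeats 0 in
/-- Rows `756 ≤ c < 864` of the certificate hold. [folklore] -/
theorem chk_756_864 : chk 756 864 = true := by decide +kernel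

/-- Rows `432 ≤ c < 864` of the certificate hold. [folklore] -/
theorem chkFile_2 : chk 432 864 = true :=
  chk_split (chk_split (chk_split chk_432_540 chk_540_648) chk_648_756) chk_756_864

end Summit.CriticalPhenomena.PercolationContinuityZ3.Theorems.Pcint.Z6S4
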